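import Summits.ResolutionOfSingularities.ResolutionOfSingularities.Theorems.FrobeniusClosingSteerBinaryResidueEvenSatelliteCone
import Summits.ResolutionOfSingularities.ResolutionOfSingularities.Theorems.FrobeniusClosingSteerBinaryResidueWindowKernelOddSquares
import HarnessLib

/-!
# hARᵒ H2 — F4b: **an EVEN SATELLITE after a B-stage forces an ON-AXIS BINARY A-stage** (case (β) of the H2ₘ decomposition, assembly;
# four-member algebra, characteristic `2`; Theses-free, def-free)

OURS (campaign `res-hironaka`, rung L ★L-G4, slot W4.1 · crux `Steer` (stmt-ResolutionOfSingularities-16345) · hARᵒ slot H2; P0 brief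
`L/res-L0-w41-plan-1/P0-BRIEF-hARo.md` b66a17a38113b83f; design res-type-062 g15 `H2-DESIGN.md` 7dac75913b6b98e3 §5 (β); seat res-D-repro-2 g9, P0 main
hand). Over F4a `BinaryResidue.mem_sup_of_law_of_clean` (the cone at `A′`), res-D-lib-2's F1′ `BinaryResidue.exists_sub_mul_sq_mem_sup_of_window`
(p553654), F1 `BinaryResidue.mem_sup_of_window` (p545669), the parity lemma (p546632) and F3's chain (p547879, copy-level for its first half).
Not a statement of the manuscript under review [claim: Hironaka2017, status: under-review]; AI-produced, weaker than expert review.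

THE SETTING: four consecutive visits `S₀ = A ≤ S₁ = B₁ ≤ S₂ = A′ ≤ S₃ = N′ ⊆ L`; window 1 `(A, B₁)` and window 2 `(B₁, A′)` BOTH along the tracked
parameter `x` (rational, adapted: `𝔪_{S₀} = (x, u)`, `u = x·u'`, `𝔪_{S₁} = (x, u') = (x, v)`, `v = x·v'`, `𝔪_{S₂} = (x, v')`); window 3 `(A′, N′)` along
`x₂` with the SATELLITE choice `w₀ = x` (`𝔪_{S₂} = (x₂, w)`, `w = x₂·w'`, `𝔪_{S₃} = (x₂, w')`); radicands `f₀ − G₀² ∈ 𝔪₀^d` (`d + 1 = 2e`), squared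
visit laws `f₁x^(d−1)W² = f₀ − G²`, `f₂x^(d+1)W₁² = f₁ − G₁²`, `f₃x₂^(d−1)W₂² = f₂ − G₂²`, cleaned orders `≥ d + 1` at `B₁`, `≥ d` at `A′`,
`≥ d + 1` at `N′`.

* `binaryResidue_of_evenSatellite` — CONCLUSION: `f₀ − G₀² ∈ (σ, τ)^d + 𝔪₀^(d+1)` with `σ, τ ∈ (u)` an `IsRsopPart` pair (binary, ON-AXIS).
  CHAIN: F3 (a)(b) at `B₁` (structure, parity: `h̃′ = h̃ − xq² ∈ 𝔪₁^d`) → weak transform `h″` at the `x`-window 2 and the structure at `A′`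
  `W²W₁²f₂ = h″ + ρ′²` → `F := W²W₁²(f₂ − γ₂²) = h″ − c²` (char 2) `∈ 𝔪₂^d` → F4a: `F ∈ (x) + (w₁, w₂)^d + 𝔪₂^(d+1)` → F1′ (`m = 2`, squares) at
  window 2 ⇒ `h̃′ − xG′² ∈ (ℓ′₀, ℓ′₁)^d + 𝔪₁^(d+1)` → F1 (`m = 2`) at window 1 ⇒ `(σ, τ)` → KEY CLAIM at two levels (regular systems `(x, v)` of
  `S₁` and `(x₂, x, w₁, w₂)` of `S₂`, units descend) ⇒ `IsRsopPart ![σ, τ]`.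
[cite: Matsumura1987, Thm. 14.2, Thm. 17.10] [folklore]
-/

noncomputable section

-- `Summit.<S>.<S>.…` duplicates the summit name by design (single-problem summit).
set_option linter.dupNamespace false

open IsLocalRing MvPolynomial

namespace Summit.ResolutionOfSingularities.ResolutionOfSingularities.Theorems.SwitchingDichotomy.BinaryResidue

open Literature.AlgebraicGeometry.Resolution

variable {L : Type} [Field L]

/-- **F4b — an even satellite after a B-stage forces an on-axis binary A-stage.** See the module docstring for the setting and the chain.
[cite: Matsumura1987, Thm. 14.2, Thm. 17.10] [folklore] -/
theorem binaryResidue_of_evenSatellite (h2 : (2 : L) = 0) (S₀ S₁ S₂ S₃ : Subring L)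
    [IsLocalRing S₀] [IsLocalRing S₁] [IsLocalRing S₂] [IsLocalRing S₃]
    (h01 : S₀ ≤ S₁) (h12 : S₁ ≤ S₂) (h23 : S₂ ≤ S₃)
    (hreg₀ : IsRegularLocalRing S₀) (hreg₁ : IsRegularLocalRing S₁) (hreg₂ : IsRegularLocalRing S₂) (hreg₃ : IsRegularLocalRing S₃)
    (hdim₀ : ringKrullDim S₀ = (4 : ℕ)) (hdim₁ : ringKrullDim S₁ = (4 : ℕ)) (hdim₂ : ringKrullDim S₂ = (4 : ℕ))
    (hdim₃ : ringKrullDim S₃ = (4 : ℕ))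
    -- window 1 (A → B₁) along `x`
    (x : S₀) (hx0 : (x : L) ≠ 0) (u : Fin 3 → S₀) (hxu : Ideal.span (insert x (Set.range u)) = maximalIdeal S₀)
    (u' : Fin 3 → S₁) (hu : ∀ j, ((u j : S₀) : L) = (x : L) * ((u' j : S₁) : L))
    (hm₁ : Ideal.span (insert (⟨(x : L), h01 x.2⟩ : S₁) (Set.range u')) = maximalIdeal S₁)
    (hrat₁ : ∀ a : S₁, ∃ b : S₀, a - ⟨(b : L), h01 b.2⟩ ∈ maximalIdeal S₁)
    -- window 2 (B₁ → A′) along `x` again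
    (v : Fin 3 → S₁) (hxv : Ideal.span (insert (⟨(x : L), h01 x.2⟩ : S₁) (Set.range v)) = maximalIdeal S₁)
    (v' : Fin 3 → S₂) (hv : ∀ j, ((v j : S₁) : L) = (x : L) * ((v' j : S₂) : L))
    (hm₂ : Ideal.span (insert (⟨(x : L), h12 (h01 x.2)⟩ : S₂) (Set.range v')) = maximalIdeal S₂)
    (hrat₂ : ∀ a : S₂, ∃ b : S₁, a - ⟨(b : L), h12 b.2⟩ ∈ maximalIdeal S₂)
    -- window 3 (A′ → N′) along `x₂`, satellite: `w 0 = x`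
    (x₂ : S₂) (hx₂0 : (x₂ : L) ≠ 0) (w : Fin 3 → S₂) (hw0 : ((w 0 : S₂) : L) = (x : L))
    (hx₂w : Ideal.span (insert x₂ (Set.range w)) = maximalIdeal S₂)
    (w' : Fin 3 → S₃) (hw : ∀ j, ((w j : S₂) : L) = (x₂ : L) * ((w' j : S₃) : L))
    (hm₃ : Ideal.span (insert (⟨(x₂ : L), h23 x₂.2⟩ : S₃) (Set.range w')) = maximalIdeal S₃)
    (hrat₃ : ∀ a : S₃, ∃ b : S₂, a - ⟨(b : L), h23 b.2⟩ ∈ maximalIdeal S₃)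
    -- radicands
    {d e : ℕ} (hde : d + 1 = 2 * e) (f₀ G₀ : S₀) (hG₀ : f₀ - G₀ ^ 2 ∈ maximalIdeal S₀ ^ d)
    (f₁ G W : S₁) (hlaw₁ : ((f₁ : S₁) : L) * (x : L) ^ (d - 1) * ((W : S₁) : L) ^ 2 = ((f₀ : S₀) : L) - ((G : S₁) : L) ^ 2)
    (hclean₁ : ∃ γ₁ : S₁, f₁ - γ₁ ^ 2 ∈ maximalIdeal S₁ ^ (d + 1))
    (f₂ G₁ W₁ : S₂) (hlaw₂ : ((f₂ : S₂) : L) * (x : L) ^ (d + 1) * ((W₁ : S₂) : L) ^ 2 = ((f₁ : S₁) : L) - ((G₁ : S₂) : L) ^ 2)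
    (hclean₂ : ∃ γ₂ : S₂, f₂ - γ₂ ^ 2 ∈ maximalIdeal S₂ ^ d)
    (f₃ G₂ W₂ : S₃) (hlaw₃ : ((f₃ : S₃) : L) * (x₂ : L) ^ (d - 1) * ((W₂ : S₃) : L) ^ 2 = ((f₂ : S₂) : L) - ((G₂ : S₃) : L) ^ 2)
    (hclean₃ : ∃ γ₃ : S₃, f₃ - γ₃ ^ 2 ∈ maximalIdeal S₃ ^ (d + 1)) :
    ∃ σ τ : S₀, σ ∈ Ideal.span (Set.range u) ∧ τ ∈ Ideal.span (Set.range u) ∧ IsRsopPart ![σ, τ] ∧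
      f₀ - G₀ ^ 2 ∈ Ideal.span {σ, τ} ^ d ⊔ maximalIdeal S₀ ^ (d + 1) := by
  classical
  haveI := hreg₀; haveI := hreg₁; haveI := hreg₂; haveI := hreg₃
  haveI := isDomain_of_isRegularLocalRing S₁
  haveI := isDomain_of_isRegularLocalRing S₂
  have he : 1 ≤ e := by omega
  have hd1 : d - 1 = 2 * (e - 1) := by omega
  have hde' : d = 2 * (e - 1) + 1 := by omega
  -- characteristic 2 in the members
  have h2S₁ : (2 : S₁) = 0 := Subtype.ext (by change S₁.subtype 2 = S₁.subtype 0; rw [map_ofNat, map_zero]; exact h2)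
  have h2S₂ : (2 : S₂) = 0 := Subtype.ext (by change S₂.subtype 2 = S₂.subtype 0; rw [map_ofNat, map_zero]; exact h2)
  -- the regular systems as `Fin 4`-families
  have hsfr : ∀ (S : Subring L) [IsRegularLocalRing S], ringKrullDim S = (4 : ℕ) → (maximalIdeal S).spanFinrank = 4 := by
    intro S _ hdim
    have h := IsRegularLocalRing.spanFinrank_maximalIdeal (R := S)
    rw [hdim] at h
    exact_mod_cast h
  set z₀ : Fin 4 → S₀ := Fin.cons x u with hz₀
  have hz₀span : Ideal.span (Set.range z₀) = maximalIdeal S₀ := by rw [hz₀, Fin.range_cons, hxu]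
  set xS₁ : S₁ := ⟨(x : L), h01 x.2⟩ with hxS₁
  set z₁ : Fin 4 → S₁ := Fin.cons xS₁ v with hz₁
  have hz₁span : Ideal.span (Set.range z₁) = maximalIdeal S₁ := by rw [hz₁, Fin.range_cons, hxv]
  have h02 : S₀ ≤ S₂ := h01.trans h12
  set xS₂ : S₂ := ⟨(x : L), h12 (h01 x.2)⟩ with hxS₂
  have hw0' : w 0 = xS₂ := Subtype.ext hw0
  set z₂ : Fin 4 → S₂ := Fin.cons x₂ w with hz₂
  have hz₂span : Ideal.span (Set.range z₂) = maximalIdeal S₂ := by rw [hz₂, Fin.range_cons, hx₂w]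
  set z₂' : Fin 4 → S₂ := Fin.cons xS₂ v' with hz₂'
  have hz₂'span : Ideal.span (Set.range z₂') = maximalIdeal S₂ := by rw [hz₂', Fin.range_cons, hm₂]
  -- `x ∈ 𝔪 ∖ 𝔪²`, prime, in `S₁` and in `S₂`
  have hxm₁ : xS₁ ∈ maximalIdeal S₁ := by rw [← hxv]; exact Ideal.subset_span (Set.mem_insert _ _)
  have hx2₁ : xS₁ ∉ maximalIdeal S₁ ^ 2 := by
    have := not_mem_sq_of_span_eq (hsfr S₁ hdim₁) z₁ hz₁span 0
    simpa [hz₁] using this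
  have hxS₁0 : xS₁ ≠ 0 := fun h => hx0 (congrArg Subtype.val h)
  have hxprime : Prime xS₁ :=
    (Ideal.span_singleton_prime hxS₁0).mp (SigmaTopLegality.isPrime_span_singleton_of_not_mem_sq S₁ hxm₁ hx2₁)
  have hxm₂ : xS₂ ∈ maximalIdeal S₂ := by rw [← hm₂]; exact Ideal.subset_span (Set.mem_insert _ _)
  have hx2₂ : xS₂ ∉ maximalIdeal S₂ ^ 2 := by
    have := not_mem_sq_of_span_eq (hsfr S₂ hdim₂) z₂' hz₂'span 0
    simpa [hz₂'] using this
  have hxS₂0 : xS₂ ≠ 0 := fun h => hx0 (congrArg Subtype.val h)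
  have hxprime₂ : Prime xS₂ :=
    (Ideal.span_singleton_prime hxS₂0).mp (SigmaTopLegality.isPrime_span_singleton_of_not_mem_sq S₂ hxm₂ hx2₂)
  -- (a) STRUCTURE at `B₁`: the weak transform `h̃ = (f₀ − G₀²)/x^d ∈ S₁` and `W²·f₁ = x·h̃ + Δ′²`
  obtain ⟨ht, hht⟩ := exists_mul_pow_eq_of_mem_pow h01 x u hxu u' hu hG₀
  set G₀S₁ : S₁ := ⟨(G₀ : L), h01 G₀.2⟩ with hG₀S₁
  have hxL : ((xS₁ : S₁) : L) = (x : L) := rfl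
  have hGL : ((G₀S₁ : S₁) : L) = (G₀ : L) := rfl
  have hsq : (G₀S₁ - G) ^ 2 = xS₁ ^ (d - 1) * (W ^ 2 * f₁ - xS₁ * ht) := by
    apply Subtype.ext
    push_cast
    rw [hxL, hGL]
    have e1 : (x : L) ^ d = (x : L) ^ (d - 1) * (x : L) := by rw [← pow_succ, show d - 1 + 1 = d by omega]
    have hhtd : ((ht : S₁) : L) * ((x : L) ^ (d - 1) * (x : L)) = ((f₀ : S₀) : L) - ((G₀ : S₀) : L) ^ 2 := by
      rw [← e1, hht]; push_cast; ring
    linear_combination (-1 : L) * hlaw₁ + (1 : L) * hhtd +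
      (((G : S₁) : L) * (((G : S₁) : L) - ((G₀ : S₀) : L))) * h2
  have hsq' : (G₀S₁ - G) ^ 2 = xS₁ ^ (2 * (e - 1)) * (W ^ 2 * f₁ - xS₁ * ht) := by rw [← hd1]; exact hsq
  obtain ⟨Δ, hΔ⟩ := pow_dvd_of_pow_two_mul_dvd_sq hxprime (e - 1) (a := G₀S₁ - G) ⟨_, hsq'⟩
  have hstruct : W ^ 2 * f₁ = xS₁ * ht + Δ ^ 2 := by
    have hne : xS₁ ^ (2 * (e - 1)) ≠ 0 := pow_ne_zero _ hxS₁0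
    have h3 : xS₁ ^ (2 * (e - 1)) * (W ^ 2 * f₁ - xS₁ * ht) = xS₁ ^ (2 * (e - 1)) * Δ ^ 2 := by
      rw [← hsq', hΔ]; ring
    have h4 := mul_left_cancel₀ hne h3
    linear_combination h4
  -- (b) PARITY at `B₁`: `h̃′ := h̃ − x q² ∈ 𝔪₁^d`
  obtain ⟨γ₁, hγ₁⟩ := hclean₁
  have hrel : xS₁ * ht - (W * γ₁ + Δ) ^ 2 ∈ maximalIdeal S₁ ^ (2 * e) := by
    have : xS₁ * ht - (W * γ₁ + Δ) ^ 2 = W ^ 2 * (f₁ - γ₁ ^ 2) := by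
      linear_combination (-1 : S₁) * hstruct + (-(W * γ₁ * Δ) - Δ ^ 2) * h2S₁
    rw [this, ← hde]
    exact Ideal.mul_mem_left _ _ hγ₁
  obtain ⟨q, hq⟩ := exists_sub_mul_sq_mem_pow_of_mul_sub_sq_mem_pow h2S₁ hxm₁ hx2₁ he hrel
  rw [show 2 * e - 1 = d by omega] at hq
  set ht' : S₁ := ht - xS₁ * q ^ 2 with hht'
  -- (c) weak transform `h″` of `h̃′` at the `x`-window 2 and the STRUCTURE at `A′`: `W²W₁²f₂ = h″ + ρ′²`
  obtain ⟨ht'', hht''⟩ := exists_mul_pow_eq_of_mem_pow h12 xS₁ v hxv v' hv hq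
  set WS₂ : S₂ := ⟨(W : L), h12 W.2⟩ with hWS₂
  have hWL : ((WS₂ : S₂) : L) = (W : L) := rfl
  have hx₂L : ((xS₂ : S₂) : L) = (x : L) := rfl
  set ρ : S₂ := ⟨(x : L) * ((q : S₁) : L) + ((Δ : S₁) : L) + ((W : S₁) : L) * ((G₁ : S₂) : L),
    S₂.add_mem (S₂.add_mem (S₂.mul_mem (h02 x.2) (h12 q.2)) (h12 Δ.2)) (S₂.mul_mem (h12 W.2) G₁.2)⟩ with hρ
  have hρL : ((ρ : S₂) : L) = (x : L) * ((q : S₁) : L) + ((Δ : S₁) : L) + ((W : S₁) : L) * ((G₁ : S₂) : L) := rfl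
  have hht'L : ((ht' : S₁) : L) = ((ht : S₁) : L) - (x : L) * ((q : S₁) : L) ^ 2 := by
    rw [hht']; push_cast; rw [hxL]
  have hmem₂ : WS₂ ^ 2 * W₁ ^ 2 * xS₂ ^ (d + 1) * f₂ = xS₂ * (ht'' * xS₂ ^ d) + ρ ^ 2 := by
    apply Subtype.ext
    push_cast
    rw [hWL, hx₂L, hρL, hht'', hht'L]
    have hstructL : ((W : S₁) : L) ^ 2 * ((f₁ : S₁) : L) = (x : L) * ((ht : S₁) : L) + ((Δ : S₁) : L) ^ 2 := by
      have := congrArg Subtype.val hstruct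
      push_cast at this
      rw [hxL] at this
      exact this
    linear_combination (((W : S₁) : L) ^ 2) * hlaw₂ + hstructL -
      (((W : S₁) : L) ^ 2 * ((G₁ : S₂) : L) ^ 2 + (x : L) * ((q : S₁) : L) * ((Δ : S₁) : L) +
        (x : L) * ((q : S₁) : L) * ((W : S₁) : L) * ((G₁ : S₂) : L) + ((Δ : S₁) : L) * ((W : S₁) : L) * ((G₁ : S₂) : L)) * h2
  obtain ⟨ρ', hρ'⟩ := pow_dvd_of_pow_two_mul_dvd_sq hxprime₂ e (a := ρ) (by
    refine ⟨WS₂ ^ 2 * W₁ ^ 2 * f₂ - ht'', ?_⟩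
    rw [← hde]
    linear_combination (-1 : S₂) * hmem₂)
  have hstruct₂ : WS₂ ^ 2 * W₁ ^ 2 * f₂ = ht'' + ρ' ^ 2 := by
    have hne : xS₂ ^ (d + 1) ≠ 0 := pow_ne_zero _ hxS₂0
    have eρ : ρ ^ 2 = xS₂ ^ (d + 1) * ρ' ^ 2 := by rw [hρ', hde]; ring
    have key : xS₂ ^ (d + 1) * (WS₂ ^ 2 * W₁ ^ 2 * f₂) = xS₂ ^ (d + 1) * (ht'' + ρ' ^ 2) := by
      linear_combination hmem₂ + eρ
    exact mul_left_cancel₀ hne key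
  -- (d) `F := W²W₁²(f₂ − γ₂²) = h″ − c² ∈ 𝔪₂^d`
  obtain ⟨γ₂, hγ₂⟩ := hclean₂
  set F : S₂ := WS₂ ^ 2 * W₁ ^ 2 * (f₂ - γ₂ ^ 2) with hF
  have hFd : F ∈ maximalIdeal S₂ ^ d := Ideal.mul_mem_left _ _ hγ₂
  set c : S₂ := WS₂ * W₁ * γ₂ + ρ' with hc
  have hFc : ht'' - c ^ 2 = F := by
    linear_combination (-1 : S₂) * hstruct₂ - (ρ' * (ρ' + WS₂ * W₁ * γ₂)) * h2S₂
  -- (e) the cone at `A′` (F4a): weak transform of `F` at window 3 and the law `(A′, N′)` with unit multiple `W W₁`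
  obtain ⟨F', hF'⟩ := exists_mul_pow_eq_of_mem_pow h23 x₂ w hx₂w w' hw hFd
  have h13 : S₁ ≤ S₃ := h12.trans h23
  set W' : S₃ := ⟨((W : S₁) : L) * ((W₁ : S₂) : L) * ((W₂ : S₃) : L),
    S₃.mul_mem (S₃.mul_mem (h13 W.2) (h23 W₁.2)) W₂.2⟩ with hW'
  set E : S₃ := ⟨((W : S₁) : L) * ((W₁ : S₂) : L) * (((γ₂ : S₂) : L) - ((G₂ : S₃) : L)),
    S₃.mul_mem (S₃.mul_mem (h13 W.2) (h23 W₁.2)) (S₃.sub_mem (h23 γ₂.2) G₂.2)⟩ with hE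
  have hFL : ((F : S₂) : L) = (W : L) ^ 2 * ((W₁ : S₂) : L) ^ 2 * (((f₂ : S₂) : L) - ((γ₂ : S₂) : L) ^ 2) := by
    rw [hF]; push_cast; rw [hWL]
  have hlawE : ((f₃ : S₃) : L) * (x₂ : L) ^ (d - 1) * ((W' : S₃) : L) ^ 2 = ((F : S₂) : L) + ((E : S₃) : L) ^ 2 := by
    rw [hFL]
    show ((f₃ : S₃) : L) * (x₂ : L) ^ (d - 1) * (((W : S₁) : L) * ((W₁ : S₂) : L) * ((W₂ : S₃) : L)) ^ 2 =
      (W : L) ^ 2 * ((W₁ : S₂) : L) ^ 2 * (((f₂ : S₂) : L) - ((γ₂ : S₂) : L) ^ 2) +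
      (((W : S₁) : L) * ((W₁ : S₂) : L) * (((γ₂ : S₂) : L) - ((G₂ : S₃) : L))) ^ 2
    linear_combination (((W : S₁) : L) ^ 2 * ((W₁ : S₂) : L) ^ 2) * hlaw₃ +
      (((W : S₁) : L) ^ 2 * ((W₁ : S₂) : L) ^ 2 * ((G₂ : S₃) : L) * (((γ₂ : S₂) : L) - ((G₂ : S₃) : L))) * h2
  have hcone := mem_sup_of_law_of_clean h2 S₂ S₃ h23 hreg₃ hdim₃ x₂ hx₂0 w hx₂w w' hw hm₃ hrat₃ hde F hFd F' hF' f₃ W' E hlawE hclean₃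
  -- (f) F1′ (m = 2, squares) at window 2 with `σ′ = (w₁, w₂)`
  have hdim₂' : ringKrullDim S₂ = ((3 : ℕ) + 1 : ℕ) := by rw [hdim₂]
  set σ' : Fin 2 → S₂ := fun k => w k.succ with hσ'
  have hwm : ∀ j, w j ∈ maximalIdeal S₂ := fun j => hx₂w ▸ Ideal.subset_span (Set.mem_insert_of_mem _ ⟨j, rfl⟩)
  have hσ'm : ∀ k, σ' k ∈ maximalIdeal S₂ := fun k => hwm k.succ
  have hinput₂ : ht'' - c ^ 2 ∈ Ideal.span (Set.range σ') ^ d ⊔ maximalIdeal S₂ ^ (d + 1) ⊔ Ideal.span {xS₂} := by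
    rw [hFc]
    obtain ⟨y, hy, m, hm, hym⟩ := Submodule.mem_sup.mp hcone
    obtain ⟨y₁, hy₁, y₂, hy₂, rfl⟩ := Submodule.mem_sup.mp hy
    rw [← hym]
    refine add_mem (add_mem ?_ (Ideal.mem_sup_left (Ideal.mem_sup_left hy₂))) (Ideal.mem_sup_left (Ideal.mem_sup_right hm))
    rw [hw0'] at hy₁
    exact Ideal.mem_sup_right hy₁
  have hlaw'' : ((ht'' : S₂) : L) * ((xS₁ : S₁) : L) ^ d = ((ht' : S₁) : L) := by rw [hxL, hht'']
  obtain ⟨a', G', hlin', hG'⟩ := exists_sub_mul_sq_mem_sup_of_window h2 S₁ S₂ h12 hreg₂ hdim₂' xS₁ hx0 v hxv v' hv hm₂ hrat₂ hde'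
    ht' ht'' hlaw'' hq σ' hσ'm c hinput₂
  -- (g) F1 (m = 2) at window 1 with `σ″ = (ℓ′₀, ℓ′₁)`
  have hdim₁' : ringKrullDim S₁ = ((3 : ℕ) + 1 : ℕ) := by rw [hdim₁]
  set ℓ' : Fin 2 → S₁ := fun k => ∑ j, a' k j * v j with hℓ'
  have hvm : ∀ j, v j ∈ maximalIdeal S₁ := fun j => hxv ▸ Ideal.subset_span (Set.mem_insert_of_mem _ ⟨j, rfl⟩)
  have hℓ'm : ∀ k, ℓ' k ∈ maximalIdeal S₁ := fun k => Ideal.sum_mem _ fun j _ => Ideal.mul_mem_left _ _ (hvm j)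
  have hinput₁ : ht ∈ Ideal.span (Set.range ℓ') ^ d ⊔ maximalIdeal S₁ ^ (d + 1) ⊔ Ideal.span {xS₁} := by
    have e1 : ht = (ht' - xS₁ * G' ^ 2) + xS₁ * (G' ^ 2 + q ^ 2) := by rw [hht']; ring
    rw [e1]
    exact add_mem (Ideal.mem_sup_left hG') (Ideal.mem_sup_right (Ideal.mul_mem_right _ _ (Ideal.mem_span_singleton_self _)))
  obtain ⟨a, hlin, hmem⟩ := mem_sup_of_window S₀ S₁ h01 hreg₁ hdim₁' x hx0 u hxu u' hu hm₁ hrat₁ (f₀ - G₀ ^ 2) ht hht hG₀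
    ℓ' hℓ'm hinput₁
  set σ : S₀ := ∑ j, a 0 j * u j with hσdef
  set τ : S₀ := ∑ j, a 1 j * u j with hτdef
  have hrange : Set.range (fun k : Fin 2 => ∑ j, a k j * u j) = {σ, τ} := by
    ext y
    simp only [Set.mem_range, Set.mem_insert_iff, Set.mem_singleton_iff, Fin.exists_fin_two, hσdef, hτdef]
    constructor
    · rintro (h | h) <;> [exact Or.inl h.symm; exact Or.inr h.symm]
    · rintro (h | h) <;> [exact Or.inl h.symm; exact Or.inr h.symm]
  rw [hrange] at hmem
  have hσu : σ ∈ Ideal.span (Set.range u) := Ideal.sum_mem _ fun j _ => Ideal.mul_mem_left _ _ (Ideal.subset_span ⟨j, rfl⟩)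
  have hτu : τ ∈ Ideal.span (Set.range u) := Ideal.sum_mem _ fun j _ => Ideal.mul_mem_left _ _ (Ideal.subset_span ⟨j, rfl⟩)
  refine ⟨σ, τ, hσu, hτu, ?_, hmem⟩
  -- (h) KEY CLAIM at two levels: `c₀σ + c₁τ ∈ 𝔪₀² ⇒ c₀, c₁ ∈ 𝔪₀`
  have hum : ∀ j, u j ∈ maximalIdeal S₀ := fun j => hxu ▸ Ideal.subset_span (Set.mem_insert_of_mem _ ⟨j, rfl⟩)
  have key : ∀ c₀ c₁ : S₀, c₀ * σ + c₁ * τ ∈ maximalIdeal S₀ ^ 2 → c₀ ∈ maximalIdeal S₀ ∧ c₁ ∈ maximalIdeal S₀ := by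
    intro c₀ c₁ hc
    -- level 0: coefficients `b_j = c₀ a₀ⱼ + c₁ a₁ⱼ ∈ 𝔪₀`
    set b : Fin 3 → S₀ := fun j => c₀ * a 0 j + c₁ * a 1 j with hb
    have hbsum : c₀ * σ + c₁ * τ = ∑ j, b j * u j := by
      simp only [hσdef, hτdef, hb, Finset.mul_sum, ← Finset.sum_add_distrib]
      refine Finset.sum_congr rfl fun j _ => by ring
    have hbm : ∀ j, b j ∈ maximalIdeal S₀ := by
      intro j
      have h := mem_maximalIdeal_of_sum_mul_rsop_mem_sq (hsfr S₀ hdim₀) z₀ hz₀span (Fin.cons 0 b) (by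
        rw [Fin.sum_univ_succ]
        simp only [hz₀, Fin.cons_zero, Fin.cons_succ, zero_mul, zero_add]
        rw [← hbsum]; exact hc) j.succ
      simpa [hz₀] using h
    -- level 1: `c₀ ℓ′₀ + c₁ ℓ′₁ ∈ 𝔪₁² + (x)`
    set c₀' : S₁ := ⟨(c₀ : L), h01 c₀.2⟩ with hc₀'
    set c₁' : S₁ := ⟨(c₁ : L), h01 c₁.2⟩ with hc₁'
    have hlin0 := hlin 0
    have hlin1 := hlin 1
    have hcomb : c₀' * ℓ' 0 + c₁' * ℓ' 1 ∈ maximalIdeal S₁ ^ 2 ⊔ Ideal.span {xS₁} := by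
      have hbS₁ : ∀ j, (⟨((b j : S₀) : L), h01 (b j).2⟩ : S₁) ∈ Ideal.span {xS₁} := fun j =>
        inclusion_mem_span_of_mem_maximalIdeal h01 x u hxu u' hu (hbm j)
      have e1 : c₀' * ℓ' 0 + c₁' * ℓ' 1 =
          c₀' * (ℓ' 0 - ∑ j, (⟨((a 0 j : S₀) : L), h01 (a 0 j).2⟩ : S₁) * u' j) +
          c₁' * (ℓ' 1 - ∑ j, (⟨((a 1 j : S₀) : L), h01 (a 1 j).2⟩ : S₁) * u' j) +
          ∑ j, (⟨((b j : S₀) : L), h01 (b j).2⟩ : S₁) * u' j := by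
        have hbj : ∀ j, (⟨((b j : S₀) : L), h01 (b j).2⟩ : S₁) =
            c₀' * ⟨((a 0 j : S₀) : L), h01 (a 0 j).2⟩ + c₁' * ⟨((a 1 j : S₀) : L), h01 (a 1 j).2⟩ := fun j =>
          Subtype.ext (by simp [hb, hc₀', hc₁'])
        simp only [hbj, Finset.mul_sum, add_mul, Finset.sum_add_distrib, mul_sub]
        simp only [mul_assoc]
        ring
      rw [e1]
      refine add_mem (add_mem (Ideal.mul_mem_left _ _ hlin0) (Ideal.mul_mem_left _ _ hlin1))
        (Ideal.mem_sup_right (Ideal.sum_mem _ fun j _ => Ideal.mul_mem_right _ _ (hbS₁ j)))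
    -- level 1: the coefficients `b′_j = c₀ a′₀ⱼ + c₁ a′₁ⱼ ∈ 𝔪₁` (regular system `(x, v)` of `S₁`)
    set b' : Fin 3 → S₁ := fun j => c₀' * a' 0 j + c₁' * a' 1 j with hb'
    have hb'sum : c₀' * ℓ' 0 + c₁' * ℓ' 1 = ∑ j, b' j * v j := by
      simp only [hℓ', hb', Finset.mul_sum, ← Finset.sum_add_distrib]
      refine Finset.sum_congr rfl fun j _ => by ring
    obtain ⟨m₁, hm₁', y₁, hy₁, hmy₁⟩ := Submodule.mem_sup.mp hcomb
    obtain ⟨r₁, hr₁⟩ := Ideal.mem_span_singleton'.mp hy₁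
    have hb'm : ∀ j, b' j ∈ maximalIdeal S₁ := by
      intro j
      set cvec : Fin 4 → S₁ := Fin.cons (-r₁) b' with hcvec
      have hsum : ∑ i, cvec i * z₁ i = c₀' * ℓ' 0 + c₁' * ℓ' 1 - y₁ := by
        rw [← hr₁, hb'sum, Fin.sum_univ_succ]
        simp only [hcvec, hz₁, Fin.cons_zero, Fin.cons_succ]
        ring
      have hmem' : ∑ i, cvec i * z₁ i ∈ maximalIdeal S₁ ^ 2 := by
        rw [hsum, ← hmy₁]; simpa using hm₁'
      have h := mem_maximalIdeal_of_sum_mul_rsop_mem_sq (hsfr S₁ hdim₁) z₁ hz₁span cvec hmem' j.succ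
      simpa [hcvec] using h
    -- level 2: `c₀ w₁ + c₁ w₂ ∈ 𝔪₂² + (x)` (window 2: `𝔪₁ ⊆ x·S₂`, and F1′'s linear parts)
    set c₀'' : S₂ := ⟨(c₀ : L), h02 c₀.2⟩ with hc₀''
    set c₁'' : S₂ := ⟨(c₁ : L), h02 c₁.2⟩ with hc₁''
    have hlin0' := hlin' 0
    have hlin1' := hlin' 1
    have hcomb₂ : c₀'' * w 1 + c₁'' * w 2 ∈ maximalIdeal S₂ ^ 2 ⊔ Ideal.span {xS₂} := by
      have hbS₂ : ∀ j, (⟨((b' j : S₁) : L), h12 (b' j).2⟩ : S₂) ∈ Ideal.span {xS₂} := fun j =>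
        inclusion_mem_span_of_mem_maximalIdeal h12 xS₁ v hxv v' hv (hb'm j)
      have e1 : c₀'' * w 1 + c₁'' * w 2 =
          c₀'' * (σ' 0 - ∑ j, (⟨((a' 0 j : S₁) : L), h12 (a' 0 j).2⟩ : S₂) * v' j) +
          c₁'' * (σ' 1 - ∑ j, (⟨((a' 1 j : S₁) : L), h12 (a' 1 j).2⟩ : S₂) * v' j) +
          ∑ j, (⟨((b' j : S₁) : L), h12 (b' j).2⟩ : S₂) * v' j := by
        have hbj : ∀ j, (⟨((b' j : S₁) : L), h12 (b' j).2⟩ : S₂) =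
            c₀'' * ⟨((a' 0 j : S₁) : L), h12 (a' 0 j).2⟩ + c₁'' * ⟨((a' 1 j : S₁) : L), h12 (a' 1 j).2⟩ := fun j =>
          Subtype.ext (by simp [hb', hc₀', hc₁', hc₀'', hc₁''])
        simp only [hbj, hσ', Finset.mul_sum, add_mul, Finset.sum_add_distrib, mul_sub]
        have e2 : (Fin.succ (0 : Fin 2) : Fin 3) = 1 := rfl
        have e3 : (Fin.succ (1 : Fin 2) : Fin 3) = 2 := rfl
        rw [e2, e3]
        simp only [mul_assoc]
        ring
      rw [e1]
      refine add_mem (add_mem (Ideal.mul_mem_left _ _ hlin0') (Ideal.mul_mem_left _ _ hlin1'))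
        (Ideal.mem_sup_right (Ideal.sum_mem _ fun j _ => Ideal.mul_mem_right _ _ (hbS₂ j)))
    obtain ⟨m₂, hm₂', y₂, hy₂, hmy₂⟩ := Submodule.mem_sup.mp hcomb₂
    obtain ⟨r₂, hr₂⟩ := Ideal.mem_span_singleton'.mp hy₂
    -- coefficient vector on the system `(x₂, w₀ = x, w₁, w₂)`: `(0, −r₂, c₀, c₁)`
    have hcS₂ : c₀'' ∈ maximalIdeal S₂ ∧ c₁'' ∈ maximalIdeal S₂ := by
      set cvec : Fin 4 → S₂ := Fin.cons 0 (Fin.cons (-r₂) (Fin.cons c₀'' (Fin.cons c₁'' Fin.elim0))) with hcvec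
      have hsum : ∑ i, cvec i * z₂ i = c₀'' * w 1 + c₁'' * w 2 - y₂ := by
        rw [← hr₂]
        simp only [Fin.sum_univ_succ, Fin.sum_univ_zero, hcvec, hz₂, Fin.cons_zero, Fin.cons_succ]
        simp only [Fin.succ_zero_eq_one, Fin.succ_one_eq_two, hw0']
        ring
      have hmem' : ∑ i, cvec i * z₂ i ∈ maximalIdeal S₂ ^ 2 := by
        rw [hsum, ← hmy₂]; simpa using hm₂'
      have h2' := mem_maximalIdeal_of_sum_mul_rsop_mem_sq (hsfr S₂ hdim₂) z₂ hz₂span cvec hmem'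
      have h2a := h2' (Fin.succ (Fin.succ 0))
      have h2b := h2' (Fin.succ (Fin.succ (Fin.succ 0)))
      simp only [hcvec, Fin.cons_succ, Fin.cons_zero] at h2a h2b
      exact ⟨h2a, h2b⟩
    -- back to `S₀`: a unit of `S₀` is a unit of `S₂`
    constructor
    · by_contra hc₀
      have hu0 : IsUnit c₀ := IsLocalRing.notMem_maximalIdeal.mp hc₀
      have : IsUnit c₀'' := (hu0.map (Subring.inclusion h02))
      exact (IsLocalRing.mem_maximalIdeal _).mp hcS₂.1 this
    · by_contra hc₁
      have hu1 : IsUnit c₁ := IsLocalRing.notMem_maximalIdeal.mp hc₁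
      have : IsUnit c₁'' := (hu1.map (Subring.inclusion h02))
      exact (IsLocalRing.mem_maximalIdeal _).mp hcS₂.2 this
  have hσm : σ ∈ maximalIdeal S₀ := Ideal.sum_mem _ fun j _ => Ideal.mul_mem_left _ _ (hum j)
  have hτm : τ ∈ maximalIdeal S₀ := Ideal.sum_mem _ fun j _ => Ideal.mul_mem_left _ _ (hum j)
  have hσ2 : σ ∉ maximalIdeal S₀ ^ 2 := fun h => by
    have := (key 1 0 (by simpa using h)).1
    exact (IsLocalRing.maximalIdeal.isMaximal S₀).ne_top (Ideal.eq_top_of_isUnit_mem _ this isUnit_one)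
  have hτ2 : τ ∉ maximalIdeal S₀ ^ 2 ⊔ Ideal.span {σ} := fun h => by
    obtain ⟨m, hm, w₀, hw₀, hmw⟩ := Submodule.mem_sup.mp h
    obtain ⟨r, hr⟩ := Ideal.mem_span_singleton'.mp hw₀
    have : (-r) * σ + 1 * τ ∈ maximalIdeal S₀ ^ 2 := by
      have e1 : (-r) * σ + 1 * τ = m := by rw [← hmw, ← hr]; ring
      rw [e1]; exact hm
    have := (key (-r) 1 this).2
    exact (IsLocalRing.maximalIdeal.isMaximal S₀).ne_top (Ideal.eq_top_of_isUnit_mem _ this isUnit_one)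
  exact SwitchPlane.isRsopPart_pair hσm hσ2 hτm hτ2

end Summit.ResolutionOfSingularities.ResolutionOfSingularities.Theorems.SwitchingDichotomy.BinaryResidue

end
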